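import Mathlib
import Summits.KontsevichZagierPeriods.Zeta5Search.Families.CubicalChartFiveSpans
import Summits.KontsevichZagierPeriods.Zeta5Search.Families.CubicalChartLeadPi8v
import Summits.KontsevichZagierPeriods.Zeta5Search.Families.SeatingGapGrowth
import Summits.KontsevichZagierPeriods.Zeta5Search.Families.CellularEightGrowthConstantsD
import Summits.KontsevichZagierPeriods.Zeta5Search.Families.BasicGrowthClasses
import Summits.KontsevichZagierPeriods.Zeta5Search.Brown8.LeadingCoefficientsA
import HarnessLib

/-!
# ζ(5) search — fam-brown8's census leading coefficients `lead_pi10` (class ₈π₁₀) and `lead_pi10v` (class ₈π₁₀^∨) ARE gap constant terms; growth exponents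

HONEST FRAMING: systematic search; no irrationality claim unless certified.  Cell `pub-zeta5`, certifier 2 (cert-2 g11,
2026-08-22).  Identities between integers (binomial sums / polynomial coefficients) and the elementary real analysis of
`Families/SeatingGapGrowth`; nothing about `ζ(5)`; no number of record moves; no conjecture node is used or discharged
(the census recurrences `Brown8.LeadRec_<class>` stay GUESSED).  These are STRUCTURE statements about the size of integers
(SCOREBOARD §C, growth side): no denominator / arithmetic model of these classes' linear forms exists in the tree (only
`₈π₈^∨` has one), and nothing here bears on irrationality.

METHOD (same for every class; dictionary `Families/CubicalChartFiveSpans`, engine `CubicalChartN.coeff_chart` of cert-2 g10,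
rate theorem `Families/SeatingGapGrowth.tendsto_log_gapCT_div`).  The census sum `lead_<class> n` of
`Brown8/LeadingCoefficientsA,B` is read off the cubical chart `z_{η₁}=0, z_{η_{k+1}} = x_k⋯x₅, z_{η₇}=1, z_{η₈}=∞` of its
frame `η`; in P2's simplicial convention (`Families/CellularIntegral`) the frame is the SEATING `τ = η⁻¹`, whose six finite
edges `τδ⁰` span gap intervals; `lead_<class> n = SeatingGap.gapCT τ n = [X^{n·𝟙}] ∏_{finite edges} (Σ_{span} X)^n`
(constant-term invariance: the four binomials of the census formula are the chart images of the four chords not through the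
point `z = 0`, its five `coeffPow (−n−1) ·` factors the five gap series), hence `lead ≥ 0`, and
`log lead_<class>(n)/n → −log M_τ` with `M_τ = fSup τ` identified with P2's certified growth constant of the atlas class of `τ`
(`Families/BasicGrowthClasses.fSup_ofSeating_eq_of_equivalent`, `Families/CellularEightGrowthConstants*`).

* CLASS ₈π₁₀ (`lead_pi10`, `Brown8/LeadingCoefficientsA`): frame `η = (1, 4, 8, 2, 5, 7, 3, 6)`, seating
  `τ = (1, 4, 7, 2, 5, 8, 6, 3)` (`tau10`, 0-based `(0, 3, 6, 1, 4, 7, 5, 2)`) ≃ atlas `(8, 2, 5, 7, 4, 1, 6, 3)` = `p8_10v` (class ₈π₁₀^∨);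
  finite-edge spans [0,3), [3,6), [1,6), [1,4), [2,5), [0,2); **`lead_pi10_eq_gapCT`**, `gapCT_tau10_one : gapCT = 19` at `n = 1`,
  **`tendsto_log_lead_pi10_div`**: `log lead_pi10(n)/n → −log fSup p8_10v`, growth factor
  `1/M(₈π₁₀^∨) ∈ (530.7288, 530.7289)` (`tendsto_log_lead_pi10_div_growth`).
* CLASS ₈π₁₀^∨ (`lead_pi10v`, `Brown8/LeadingCoefficientsA`): frame `η = (1, 4, 7, 5, 2, 8, 3, 6)`, seating
  `τ = (1, 5, 7, 2, 4, 8, 3, 6)` (`tau10v`, 0-based `(0, 4, 6, 1, 3, 7, 2, 5)`) ≃ atlas `(8, 2, 5, 7, 3, 6, 1, 4)` = `p8_10` (class ₈π₁₀);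
  finite-edge spans [0,4), [4,6), [1,6), [1,3), [2,5), [0,5); **`lead_pi10v_eq_gapCT`**, `gapCT_tau10v_one : gapCT = 23` at `n = 1`,
  **`tendsto_log_lead_pi10v_div`**: `log lead_pi10v(n)/n → −log fSup p8_10`, growth factor
  `1/M(₈π₁₀) ∈ (700.5342, 700.5343)` (`tendsto_log_lead_pi10v_div_growth`).
Exact cross-check outside the kernel: `HOME/cert-2/g11/code/s1_classes_tau.py` (`lead = gapCT τ` for `n ≤ 6`, every class;
the equivalent atlas plan; `lead(6)/lead(5)` against `1/M`).  Standard axioms only.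
-/

noncomputable section

open MvPowerSeries Finset

namespace Summit.KontsevichZagierPeriods.Zeta5Search.Families.Cellular

namespace CubicalChartN

open Summit.KontsevichZagierPeriods.Zeta5Search.Brown8 (coeffPow sumTo lead_pi10 lead_pi10_values lead_pi10v lead_pi10v_values)
open CubicalChart (coeffPow_nat_nat)

/-! # Class ₈π₁₀: `lead_pi10` -/

/-! ### The seating `τ = η⁻¹` -/

/-- The inverse `τ = (1, 4, 7, 2, 5, 8, 6, 3)` of the census frame `η = (1, 4, 8, 2, 5, 7, 3, 6)` of class ₈π₁₀, 0-based. -/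
def tau10 : Fin 8 → Fin 8 := ![0, 3, 6, 1, 4, 7, 5, 2]

/-- `τ` is the printed list `(1, 4, 7, 2, 5, 8, 6, 3)` read 0-based, and is bijective. -/
theorem tau10_spec : tau10 = ofSeating (ℓ := 5) [1, 4, 7, 2, 5, 8, 6, 3] ∧ Function.Bijective tau10 :=
  ⟨by decide, Finite.injective_iff_bijective.1 (by decide)⟩

/-- `τ` is the inverse of the frame `η = (1, 4, 8, 2, 5, 7, 3, 6)` (0-based `(0, 3, 7, 1, 4, 6, 2, 5)`). -/
theorem tau10_inverse : ∀ i, tau10 ((![0, 3, 7, 1, 4, 6, 2, 5] : Fin 8 → Fin 8) i) = i ∧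
    (![0, 3, 7, 1, 4, 6, 2, 5] : Fin 8 → Fin 8) (tau10 i) = i := by decide

/-- `τ` is a seating of class ₈π₁₀^∨: equivalent [Brown2016, Def. 3.1] to the atlas plan `(8, 2, 5, 7, 4, 1, 6, 3)`. -/
theorem tau10_equiv : Literature.NumberTheory.Irrationality.Brown2016.Equivalent 8 [1, 4, 7, 2, 5, 8, 6, 3]
    [8, 2, 5, 7, 4, 1, 6, 3] := by decide

/-! ### The gap polynomial of `τ`, explicitly -/

/-- **The gap polynomial of `τ`** (finite edges `{0,3}, {3,6}, {6,1}, {1,4}, {5,2}, {2,0}` of `τδ⁰` spanning [0,3), [3,6), [1,6), [1,4), [2,5), [0,2); the edges `{4,7}, {7,5}` pass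
through `∞ = 7`). -/
theorem gapPoly_tau10 (n : ℕ) : SeatingGap.gapPoly tau10 n =
    (MvPolynomial.X 0 + MvPolynomial.X 1 + MvPolynomial.X 2) ^ n *
    (MvPolynomial.X 3 + MvPolynomial.X 4 + MvPolynomial.X 5) ^ n *
    (MvPolynomial.X 1 + MvPolynomial.X 2 + MvPolynomial.X 3 + MvPolynomial.X 4 + MvPolynomial.X 5) ^ n *
    (MvPolynomial.X 1 + MvPolynomial.X 2 + MvPolynomial.X 3) ^ n *
    (MvPolynomial.X 2 + MvPolynomial.X 3 + MvPolynomial.X 4) ^ n *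
    (MvPolynomial.X 0 + MvPolynomial.X 1) ^ n := by
  have t0 : SpanHall.spanPoly (SeatingGap.edgeSpan tau10) 0 ^ SeatingGap.finExp tau10 n 0 =
      (MvPolynomial.X 0 + MvPolynomial.X 1 + MvPolynomial.X 2) ^ n := by
    rw [SpanHall.spanPoly, show SeatingGap.edgeSpan tau10 0 = (univ.filter fun w : Fin 6 => 0 ≤ w.val ∧ w.val < 3) by decide,
      sumX_span02, show SeatingGap.finExp tau10 n 0 = n by simp [SeatingGap.finExp, tau10]]
  have t1 : SpanHall.spanPoly (SeatingGap.edgeSpan tau10) 1 ^ SeatingGap.finExp tau10 n 1 =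
      (MvPolynomial.X 3 + MvPolynomial.X 4 + MvPolynomial.X 5) ^ n := by
    rw [SpanHall.spanPoly, show SeatingGap.edgeSpan tau10 1 = (univ.filter fun w : Fin 6 => 3 ≤ w.val ∧ w.val < 6) by decide,
      sumX_span35, show SeatingGap.finExp tau10 n 1 = n by simp [SeatingGap.finExp, tau10]]
  have t2 : SpanHall.spanPoly (SeatingGap.edgeSpan tau10) 2 ^ SeatingGap.finExp tau10 n 2 =
      (MvPolynomial.X 1 + MvPolynomial.X 2 + MvPolynomial.X 3 + MvPolynomial.X 4 + MvPolynomial.X 5) ^ n := by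
    rw [SpanHall.spanPoly, show SeatingGap.edgeSpan tau10 2 = (univ.filter fun w : Fin 6 => 1 ≤ w.val ∧ w.val < 6) by decide,
      sumX_span15, show SeatingGap.finExp tau10 n 2 = n by simp [SeatingGap.finExp, tau10]]
  have t3 : SpanHall.spanPoly (SeatingGap.edgeSpan tau10) 3 ^ SeatingGap.finExp tau10 n 3 =
      (MvPolynomial.X 1 + MvPolynomial.X 2 + MvPolynomial.X 3) ^ n := by
    rw [SpanHall.spanPoly, show SeatingGap.edgeSpan tau10 3 = (univ.filter fun w : Fin 6 => 1 ≤ w.val ∧ w.val < 4) by decide,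
      sumX_span13, show SeatingGap.finExp tau10 n 3 = n by simp [SeatingGap.finExp, tau10]]
  have t4 : SpanHall.spanPoly (SeatingGap.edgeSpan tau10) 4 ^ SeatingGap.finExp tau10 n 4 = 1 := by
    rw [show SeatingGap.finExp tau10 n 4 = 0 by simp [SeatingGap.finExp, tau10], pow_zero]
  have t5 : SpanHall.spanPoly (SeatingGap.edgeSpan tau10) 5 ^ SeatingGap.finExp tau10 n 5 = 1 := by
    rw [show SeatingGap.finExp tau10 n 5 = 0 by simp [SeatingGap.finExp, tau10], pow_zero]
  have t6 : SpanHall.spanPoly (SeatingGap.edgeSpan tau10) 6 ^ SeatingGap.finExp tau10 n 6 =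
      (MvPolynomial.X 2 + MvPolynomial.X 3 + MvPolynomial.X 4) ^ n := by
    rw [SpanHall.spanPoly, show SeatingGap.edgeSpan tau10 6 = (univ.filter fun w : Fin 6 => 2 ≤ w.val ∧ w.val < 5) by decide,
      sumX_span24, show SeatingGap.finExp tau10 n 6 = n by simp [SeatingGap.finExp, tau10]]
  have t7 : SpanHall.spanPoly (SeatingGap.edgeSpan tau10) 7 ^ SeatingGap.finExp tau10 n 7 =
      (MvPolynomial.X 0 + MvPolynomial.X 1) ^ n := by
    rw [SpanHall.spanPoly, show SeatingGap.edgeSpan tau10 7 = (univ.filter fun w : Fin 6 => 0 ≤ w.val ∧ w.val < 2) by decide,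
      sumX_span01, show SeatingGap.finExp tau10 n 7 = n by simp [SeatingGap.finExp, tau10]]
  unfold SeatingGap.gapPoly SpanHall.spanProd
  show ∏ i : Fin 8, SpanHall.spanPoly (SeatingGap.edgeSpan tau10) i ^ SeatingGap.finExp tau10 n i = _
  rw [Fin.prod_univ_eight, t0, t1, t2, t3, t4, t5, t6, t7]
  ring

/-! ### The chart image of the gap polynomial -/

/-- The prefactor monomial of the chart image, as a product. -/
theorem monomial_c10 (n : ℕ) :
    (monomial (n • tail (1 : Fin 6) + n • tail (2 : Fin 6) + n • tail (3 : Fin 6) + n • tail (4 : Fin 6)) (1 : ℤ) : T 5) = (x 1 * x 2 * x 3 * x 4) ^ n * (x 2 * x 3 * x 4) ^ n * (x 3 * x 4) ^ n * x 4 ^ n := by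
  rw [MvPowerSeries.monomial_one_eq, Finsupp.prod_fintype _ _ (fun i => by simp)]
  simp only [Fin.prod_univ_five, Finsupp.coe_add, Finsupp.coe_smul, Pi.add_apply, Pi.smul_apply, tail_apply,
    smul_eq_mul]
  simp only [Fin.isValue, Fin.val_zero, Fin.val_one, Fin.val_two, show (3 : Fin 6).val = 3 from rfl, show (4 : Fin 6).val = 4 from rfl, show (3 : Fin 5).val = 3 from rfl, show (4 : Fin 5).val = 4 from rfl]
  norm_num
  ring

/-- **The chart image of the gap polynomial of `τ`**, binomial factors in the census file's summation order
`k₁ ↦ 1−x^(seg 0 2)`, `k₂ ↦ 1−x^(seg 0 4)`, `k₃ ↦ 1−x^(seg 1 3)`, `k₄ ↦ 1−x^(seg 2 4)` (0-based variables). -/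
theorem chart_gapPoly_tau10 (n : ℕ) :
    chart (SeatingGap.gapPoly tau10 n) = (monomial (n • tail (1 : Fin 6) + n • tail (2 : Fin 6) + n • tail (3 : Fin 6) + n • tail (4 : Fin 6)) 1 : T 5) *
      ((1 - monomial (seg 0 2) 1) ^ n * ((1 - monomial (seg 0 4) 1) ^ n * ((1 - monomial (seg 1 3) 1) ^ n *
        (1 - monomial (seg 2 4) 1) ^ n))) := by
  rw [gapPoly_tau10, map_mul, map_mul, map_mul, map_mul, map_mul, map_pow, map_pow, map_pow, map_pow, map_pow, map_pow,
    chart_span02, chart_span35, chart_span15, chart_span13, chart_span24, chart_span01, monomial_c10,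
    monomial_seg02, monomial_seg04, monomial_seg13, monomial_seg24]
  simp only [mul_pow]
  ring

/-! ### The census sum -/

/-- **fam-brown8's census leading coefficient of class ₈π₁₀ IS the diagonal gap constant term of the seating `τ`**:
`lead_pi10 n = gapCT tau10 n` for every `n`. -/
theorem lead_pi10_eq_gapCT (n : ℕ) : lead_pi10 n = SeatingGap.gapCT tau10 n := by
  -- homogeneity: `6n`
  have hdeg : (SeatingGap.gapPoly tau10 n).IsHomogeneous (∑ w : Fin 6, (fun _ : Fin 6 => n) w) := by
    have h := SeatingGap.gapPoly_isHomogeneous tau10 n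
    have e : ∑ i, SeatingGap.finExp tau10 n i = ∑ w : Fin 6, (fun _ : Fin 6 => n) w := by
      simp [SeatingGap.finExp, tau10, Fin.sum_univ_eight]; ring
    rwa [e] at h
  have hct := coeff_chart (SeatingGap.gapPoly tau10 n) (fun _ : Fin 6 => n) hdeg
  symm
  unfold SeatingGap.gapCT
  rw [SeatingGap.smul_ones, ← hct, ← coeffZ_natCast, chart_gapPoly_tau10, mul_assoc, coeffZ_monomial_mul]
  simp only [mul_assoc, coeffZ_oneSubPow_mul, coeffZ_U, Finset.mul_sum]
  -- the census side
  unfold lead_pi10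
  simp only [CubicalChart.sumTo_eq_sum]
  refine Finset.sum_congr rfl fun k₁ _ => Finset.sum_congr rfl fun k₂ _ => Finset.sum_congr rfl fun k₃ _ =>
    Finset.sum_congr rfl fun k₄ _ => ?_
  simp only [coeffPow_nat_nat]
  rw [Fin.prod_univ_five]
  simp only [Mexp_apply6, Fin.sum_univ_six, Finsupp.coe_equivFunOnFinite_symm, Finsupp.coe_add, Finsupp.coe_smul,
    Pi.add_apply, Pi.smul_apply, smul_eq_mul, tail_apply, seg_apply, Fin.isValue]
  simp only [Fin.val_zero, Fin.val_one, Fin.val_two, show (3 : Fin 6).val = 3 from rfl,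
    show (4 : Fin 6).val = 4 from rfl, show (5 : Fin 6).val = 5 from rfl, show (3 : Fin 5).val = 3 from rfl,
    show (4 : Fin 5).val = 4 from rfl]
  norm_num
  ring_nf

/-- `lead_pi10 n ≥ 0` (a count of transport tables). -/
theorem lead_pi10_nonneg (n : ℕ) : 0 ≤ lead_pi10 n := by
  rw [lead_pi10_eq_gapCT]; exact SeatingGap.gapCT_nonneg tau10 n

/-- `gapCT τ 1 = 19` (the census value `lead_pi10 1 = 19`). -/
theorem gapCT_tau10_one : SeatingGap.gapCT tau10 1 = 19 := by
  rw [← lead_pi10_eq_gapCT]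
  have h := lead_pi10_values
  simp only [List.cons.injEq] at h
  exact h.2.1

/-! ### The growth exponent of `lead_pi10` -/

/-- **`M_τ = M(₈π₁₀^∨)`**: the growth constant of the seating `τ` is that of the atlas representative `p8_10v`
(class function, `Families/BasicGrowthClasses.fSup_ofSeating_eq_of_equivalent`). -/
theorem fSup_tau10 : fSup tau10 = fSup p8_10v := by
  rw [tau10_spec.1, p8_10v_spec.1]
  exact fSup_ofSeating_eq_of_equivalent (by decide) (by decide) tau10_equiv

/-- **Growth exponent of the census leading coefficients of class ₈π₁₀**: `log lead_pi10(n) / n → −log M(₈π₁₀^∨)`,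
`M(₈π₁₀^∨) = fSup p8_10v` the growth constant of the basic cellular integrals of the seating `τ` (P2,
`Families/CellularEightGrowthConstantsD`): growth of the leading coefficients = reciprocal of the decay of those integrals
(`Families/SeatingGapGrowth`). -/
theorem tendsto_log_lead_pi10_div :
    Filter.Tendsto (fun n : ℕ => Real.log (lead_pi10 n : ℝ) / n) Filter.atTop (nhds (-Real.log (fSup p8_10v))) := by
  have h := SeatingGap.tendsto_log_gapCT_div tau10 tau10_spec.2 (by rw [gapCT_tau10_one]; norm_num)
  rw [fSup_tau10] at h
  exact h.congr fun n => by rw [lead_pi10_eq_gapCT]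

/-- **The growth factor, certified**: `log lead_pi10(n)/n → log λ` with `λ = 1/M(₈π₁₀^∨) ∈ (530.7288, 530.7289)`
(P2's enclosure `fSup_p8_10v_mem_Icc`). -/
theorem tendsto_log_lead_pi10_div_growth : ∃ lam : ℝ, lam = (fSup p8_10v)⁻¹ ∧
    (5307288 : ℝ) / 10000 < lam ∧ lam < (5307289 : ℝ) / 10000 ∧
    Filter.Tendsto (fun n : ℕ => Real.log (lead_pi10 n : ℝ) / n) Filter.atTop (nhds (Real.log lam)) := by
  have hpos : 0 < fSup p8_10v := fSup_pos p8_10v (Finite.injective_iff_bijective.1 p8_10v_spec.2.1)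
  obtain ⟨hlo, hhi⟩ := fSup_p8_10v_mem_Icc
  refine ⟨(fSup p8_10v)⁻¹, rfl, ?_, ?_, ?_⟩
  · rw [lt_inv_comm₀ (by norm_num) hpos]
    exact lt_of_le_of_lt hhi (by norm_num)
  · rw [inv_lt_comm₀ hpos (by norm_num)]
    exact lt_of_lt_of_le (by norm_num) hlo
  · rw [Real.log_inv]
    exact tendsto_log_lead_pi10_div


/-! # Class ₈π₁₀^∨: `lead_pi10v` -/

/-! ### The seating `τ = η⁻¹` -/

/-- The inverse `τ = (1, 5, 7, 2, 4, 8, 3, 6)` of the census frame `η = (1, 4, 7, 5, 2, 8, 3, 6)` of class ₈π₁₀^∨, 0-based. -/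
def tau10v : Fin 8 → Fin 8 := ![0, 4, 6, 1, 3, 7, 2, 5]

/-- `τ` is the printed list `(1, 5, 7, 2, 4, 8, 3, 6)` read 0-based, and is bijective. -/
theorem tau10v_spec : tau10v = ofSeating (ℓ := 5) [1, 5, 7, 2, 4, 8, 3, 6] ∧ Function.Bijective tau10v :=
  ⟨by decide, Finite.injective_iff_bijective.1 (by decide)⟩

/-- `τ` is the inverse of the frame `η = (1, 4, 7, 5, 2, 8, 3, 6)` (0-based `(0, 3, 6, 4, 1, 7, 2, 5)`). -/
theorem tau10v_inverse : ∀ i, tau10v ((![0, 3, 6, 4, 1, 7, 2, 5] : Fin 8 → Fin 8) i) = i ∧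
    (![0, 3, 6, 4, 1, 7, 2, 5] : Fin 8 → Fin 8) (tau10v i) = i := by decide

/-- `τ` is a seating of class ₈π₁₀: equivalent [Brown2016, Def. 3.1] to the atlas plan `(8, 2, 5, 7, 3, 6, 1, 4)`. -/
theorem tau10v_equiv : Literature.NumberTheory.Irrationality.Brown2016.Equivalent 8 [1, 5, 7, 2, 4, 8, 3, 6]
    [8, 2, 5, 7, 3, 6, 1, 4] := by decide

/-! ### The gap polynomial of `τ`, explicitly -/

/-- **The gap polynomial of `τ`** (finite edges `{0,4}, {4,6}, {6,1}, {1,3}, {2,5}, {5,0}` of `τδ⁰` spanning [0,4), [4,6), [1,6), [1,3), [2,5), [0,5); the edges `{3,7}, {7,2}` pass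
through `∞ = 7`). -/
theorem gapPoly_tau10v (n : ℕ) : SeatingGap.gapPoly tau10v n =
    (MvPolynomial.X 0 + MvPolynomial.X 1 + MvPolynomial.X 2 + MvPolynomial.X 3) ^ n *
    (MvPolynomial.X 4 + MvPolynomial.X 5) ^ n *
    (MvPolynomial.X 1 + MvPolynomial.X 2 + MvPolynomial.X 3 + MvPolynomial.X 4 + MvPolynomial.X 5) ^ n *
    (MvPolynomial.X 1 + MvPolynomial.X 2) ^ n *
    (MvPolynomial.X 2 + MvPolynomial.X 3 + MvPolynomial.X 4) ^ n *
    (MvPolynomial.X 0 + MvPolynomial.X 1 + MvPolynomial.X 2 + MvPolynomial.X 3 + MvPolynomial.X 4) ^ n := by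
  have t0 : SpanHall.spanPoly (SeatingGap.edgeSpan tau10v) 0 ^ SeatingGap.finExp tau10v n 0 =
      (MvPolynomial.X 0 + MvPolynomial.X 1 + MvPolynomial.X 2 + MvPolynomial.X 3) ^ n := by
    rw [SpanHall.spanPoly, show SeatingGap.edgeSpan tau10v 0 = (univ.filter fun w : Fin 6 => 0 ≤ w.val ∧ w.val < 4) by decide,
      sumX_span03, show SeatingGap.finExp tau10v n 0 = n by simp [SeatingGap.finExp, tau10v]]
  have t1 : SpanHall.spanPoly (SeatingGap.edgeSpan tau10v) 1 ^ SeatingGap.finExp tau10v n 1 =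
      (MvPolynomial.X 4 + MvPolynomial.X 5) ^ n := by
    rw [SpanHall.spanPoly, show SeatingGap.edgeSpan tau10v 1 = (univ.filter fun w : Fin 6 => 4 ≤ w.val ∧ w.val < 6) by decide,
      sumX_span45, show SeatingGap.finExp tau10v n 1 = n by simp [SeatingGap.finExp, tau10v]]
  have t2 : SpanHall.spanPoly (SeatingGap.edgeSpan tau10v) 2 ^ SeatingGap.finExp tau10v n 2 =
      (MvPolynomial.X 1 + MvPolynomial.X 2 + MvPolynomial.X 3 + MvPolynomial.X 4 + MvPolynomial.X 5) ^ n := by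
    rw [SpanHall.spanPoly, show SeatingGap.edgeSpan tau10v 2 = (univ.filter fun w : Fin 6 => 1 ≤ w.val ∧ w.val < 6) by decide,
      sumX_span15, show SeatingGap.finExp tau10v n 2 = n by simp [SeatingGap.finExp, tau10v]]
  have t3 : SpanHall.spanPoly (SeatingGap.edgeSpan tau10v) 3 ^ SeatingGap.finExp tau10v n 3 =
      (MvPolynomial.X 1 + MvPolynomial.X 2) ^ n := by
    rw [SpanHall.spanPoly, show SeatingGap.edgeSpan tau10v 3 = (univ.filter fun w : Fin 6 => 1 ≤ w.val ∧ w.val < 3) by decide,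
      sumX_span12, show SeatingGap.finExp tau10v n 3 = n by simp [SeatingGap.finExp, tau10v]]
  have t4 : SpanHall.spanPoly (SeatingGap.edgeSpan tau10v) 4 ^ SeatingGap.finExp tau10v n 4 = 1 := by
    rw [show SeatingGap.finExp tau10v n 4 = 0 by simp [SeatingGap.finExp, tau10v], pow_zero]
  have t5 : SpanHall.spanPoly (SeatingGap.edgeSpan tau10v) 5 ^ SeatingGap.finExp tau10v n 5 = 1 := by
    rw [show SeatingGap.finExp tau10v n 5 = 0 by simp [SeatingGap.finExp, tau10v], pow_zero]
  have t6 : SpanHall.spanPoly (SeatingGap.edgeSpan tau10v) 6 ^ SeatingGap.finExp tau10v n 6 =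
      (MvPolynomial.X 2 + MvPolynomial.X 3 + MvPolynomial.X 4) ^ n := by
    rw [SpanHall.spanPoly, show SeatingGap.edgeSpan tau10v 6 = (univ.filter fun w : Fin 6 => 2 ≤ w.val ∧ w.val < 5) by decide,
      sumX_span24, show SeatingGap.finExp tau10v n 6 = n by simp [SeatingGap.finExp, tau10v]]
  have t7 : SpanHall.spanPoly (SeatingGap.edgeSpan tau10v) 7 ^ SeatingGap.finExp tau10v n 7 =
      (MvPolynomial.X 0 + MvPolynomial.X 1 + MvPolynomial.X 2 + MvPolynomial.X 3 + MvPolynomial.X 4) ^ n := by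
    rw [SpanHall.spanPoly, show SeatingGap.edgeSpan tau10v 7 = (univ.filter fun w : Fin 6 => 0 ≤ w.val ∧ w.val < 5) by decide,
      sumX_span04, show SeatingGap.finExp tau10v n 7 = n by simp [SeatingGap.finExp, tau10v]]
  unfold SeatingGap.gapPoly SpanHall.spanProd
  show ∏ i : Fin 8, SpanHall.spanPoly (SeatingGap.edgeSpan tau10v) i ^ SeatingGap.finExp tau10v n i = _
  rw [Fin.prod_univ_eight, t0, t1, t2, t3, t4, t5, t6, t7]
  ring

/-! ### The chart image of the gap polynomial -/

/-- The prefactor monomial of the chart image, as a product. -/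
theorem monomial_c10v (n : ℕ) :
    (monomial (n • tail (2 : Fin 6) + n • tail (3 : Fin 6) + (2 * n) • tail (4 : Fin 6)) (1 : ℤ) : T 5) = (x 2 * x 3 * x 4) ^ n * (x 3 * x 4) ^ n * x 4 ^ (2 * n) := by
  rw [MvPowerSeries.monomial_one_eq, Finsupp.prod_fintype _ _ (fun i => by simp)]
  simp only [Fin.prod_univ_five, Finsupp.coe_add, Finsupp.coe_smul, Pi.add_apply, Pi.smul_apply, tail_apply,
    smul_eq_mul]
  simp only [Fin.isValue, Fin.val_zero, Fin.val_one, Fin.val_two, show (3 : Fin 6).val = 3 from rfl, show (4 : Fin 6).val = 4 from rfl, show (3 : Fin 5).val = 3 from rfl, show (4 : Fin 5).val = 4 from rfl]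
  norm_num
  ring

/-- **The chart image of the gap polynomial of `τ`**, binomial factors in the census file's summation order
`k₁ ↦ 1−x^(seg 0 1)`, `k₂ ↦ 1−x^(seg 0 4)`, `k₃ ↦ 1−x^(seg 1 3)`, `k₄ ↦ 1−x^(seg 3 4)` (0-based variables). -/
theorem chart_gapPoly_tau10v (n : ℕ) :
    chart (SeatingGap.gapPoly tau10v n) = (monomial (n • tail (2 : Fin 6) + n • tail (3 : Fin 6) + (2 * n) • tail (4 : Fin 6)) 1 : T 5) *
      ((1 - monomial (seg 0 1) 1) ^ n * ((1 - monomial (seg 0 4) 1) ^ n * ((1 - monomial (seg 1 3) 1) ^ n *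
        (1 - monomial (seg 3 4) 1) ^ n))) := by
  rw [gapPoly_tau10v, map_mul, map_mul, map_mul, map_mul, map_mul, map_pow, map_pow, map_pow, map_pow, map_pow, map_pow,
    chart_span03, chart_span45, chart_span15, chart_span12, chart_span24, chart_span04, monomial_c10v,
    monomial_seg01, monomial_seg04, monomial_seg13, monomial_seg34]
  simp only [mul_pow]
  ring

/-! ### The census sum -/

/-- **fam-brown8's census leading coefficient of class ₈π₁₀^∨ IS the diagonal gap constant term of the seating `τ`**:
`lead_pi10v n = gapCT tau10v n` for every `n`. -/
theorem lead_pi10v_eq_gapCT (n : ℕ) : lead_pi10v n = SeatingGap.gapCT tau10v n := by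
  -- homogeneity: `6n`
  have hdeg : (SeatingGap.gapPoly tau10v n).IsHomogeneous (∑ w : Fin 6, (fun _ : Fin 6 => n) w) := by
    have h := SeatingGap.gapPoly_isHomogeneous tau10v n
    have e : ∑ i, SeatingGap.finExp tau10v n i = ∑ w : Fin 6, (fun _ : Fin 6 => n) w := by
      simp [SeatingGap.finExp, tau10v, Fin.sum_univ_eight]; ring
    rwa [e] at h
  have hct := coeff_chart (SeatingGap.gapPoly tau10v n) (fun _ : Fin 6 => n) hdeg
  symm
  unfold SeatingGap.gapCT
  rw [SeatingGap.smul_ones, ← hct, ← coeffZ_natCast, chart_gapPoly_tau10v, mul_assoc, coeffZ_monomial_mul]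
  simp only [mul_assoc, coeffZ_oneSubPow_mul, coeffZ_U, Finset.mul_sum]
  -- the census side
  unfold lead_pi10v
  simp only [CubicalChart.sumTo_eq_sum]
  refine Finset.sum_congr rfl fun k₁ _ => Finset.sum_congr rfl fun k₂ _ => Finset.sum_congr rfl fun k₃ _ =>
    Finset.sum_congr rfl fun k₄ _ => ?_
  simp only [coeffPow_nat_nat]
  rw [Fin.prod_univ_five]
  simp only [Mexp_apply6, Fin.sum_univ_six, Finsupp.coe_equivFunOnFinite_symm, Finsupp.coe_add, Finsupp.coe_smul,
    Pi.add_apply, Pi.smul_apply, smul_eq_mul, tail_apply, seg_apply, Fin.isValue]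
  simp only [Fin.val_zero, Fin.val_one, Fin.val_two, show (3 : Fin 6).val = 3 from rfl,
    show (4 : Fin 6).val = 4 from rfl, show (5 : Fin 6).val = 5 from rfl, show (3 : Fin 5).val = 3 from rfl,
    show (4 : Fin 5).val = 4 from rfl]
  norm_num
  ring_nf

/-- `lead_pi10v n ≥ 0` (a count of transport tables). -/
theorem lead_pi10v_nonneg (n : ℕ) : 0 ≤ lead_pi10v n := by
  rw [lead_pi10v_eq_gapCT]; exact SeatingGap.gapCT_nonneg tau10v n

/-- `gapCT τ 1 = 23` (the census value `lead_pi10v 1 = 23`). -/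
theorem gapCT_tau10v_one : SeatingGap.gapCT tau10v 1 = 23 := by
  rw [← lead_pi10v_eq_gapCT]
  have h := lead_pi10v_values
  simp only [List.cons.injEq] at h
  exact h.2.1

/-! ### The growth exponent of `lead_pi10v` -/

/-- **`M_τ = M(₈π₁₀)`**: the growth constant of the seating `τ` is that of the atlas representative `p8_10`
(class function, `Families/BasicGrowthClasses.fSup_ofSeating_eq_of_equivalent`). -/
theorem fSup_tau10v : fSup tau10v = fSup p8_10 := by
  rw [tau10v_spec.1, p8_10_spec.1]
  exact fSup_ofSeating_eq_of_equivalent (by decide) (by decide) tau10v_equiv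

/-- **Growth exponent of the census leading coefficients of class ₈π₁₀^∨**: `log lead_pi10v(n) / n → −log M(₈π₁₀)`,
`M(₈π₁₀) = fSup p8_10` the growth constant of the basic cellular integrals of the seating `τ` (P2,
`Families/CellularEightGrowthConstantsD`): growth of the leading coefficients = reciprocal of the decay of those integrals
(`Families/SeatingGapGrowth`). -/
theorem tendsto_log_lead_pi10v_div :
    Filter.Tendsto (fun n : ℕ => Real.log (lead_pi10v n : ℝ) / n) Filter.atTop (nhds (-Real.log (fSup p8_10))) := by
  have h := SeatingGap.tendsto_log_gapCT_div tau10v tau10v_spec.2 (by rw [gapCT_tau10v_one]; norm_num)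
  rw [fSup_tau10v] at h
  exact h.congr fun n => by rw [lead_pi10v_eq_gapCT]

/-- **The growth factor, certified**: `log lead_pi10v(n)/n → log λ` with `λ = 1/M(₈π₁₀) ∈ (700.5342, 700.5343)`
(P2's enclosure `fSup_p8_10_mem_Icc`). -/
theorem tendsto_log_lead_pi10v_div_growth : ∃ lam : ℝ, lam = (fSup p8_10)⁻¹ ∧
    (7005342 : ℝ) / 10000 < lam ∧ lam < (7005343 : ℝ) / 10000 ∧
    Filter.Tendsto (fun n : ℕ => Real.log (lead_pi10v n : ℝ) / n) Filter.atTop (nhds (Real.log lam)) := by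
  have hpos : 0 < fSup p8_10 := fSup_pos p8_10 (Finite.injective_iff_bijective.1 p8_10_spec.2.1)
  obtain ⟨hlo, hhi⟩ := fSup_p8_10_mem_Icc
  refine ⟨(fSup p8_10)⁻¹, rfl, ?_, ?_, ?_⟩
  · rw [lt_inv_comm₀ (by norm_num) hpos]
    exact lt_of_le_of_lt hhi (by norm_num)
  · rw [inv_lt_comm₀ hpos (by norm_num)]
    exact lt_of_lt_of_le (by norm_num) hlo
  · rw [Real.log_inv]
    exact tendsto_log_lead_pi10v_div


end CubicalChartN

end Summit.KontsevichZagierPeriods.Zeta5Search.Families.Cellular
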